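import Summits.BirchSwinnertonDyer.Rank1Residual.X9.IwasawaLowerBound
import Literature.NumberTheory.EllipticCurves.Wuthrich2014.RankOneConverseProofs
import HarnessLib

/-!
# Class X9, analytic rank 1: the LOWER bound `ord_p #Ш ≥ ord_p #Ш_an` from PUBLISHED theorems plus
# two finite certificates (`μ(𝓛_p(E)) = 0` and Schneider's `Reg_p(E) ≠ 0`) — so on X9 the typed
# residue is the Euler-system half in BOTH ranks (cell `b2b-bsdres`, unit `b2b-bsdres-x9`, gen 10)

HONEST FRAMING (run/shared/lean/b2b/bsd-rank1-residual/, verbatim in every file): the goal of the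
cell is to DELETE the COMBINATION-SHAPED residual classes of the Birch–Swinnerton-Dyer formula for
ALL analytic-rank `≤ 1` elliptic curves over `ℚ` — "full BSD formula for every rank `≤ 1` curve in
class `C`" assembled STRICTLY from published theorems — so that the rank-`≤ 1` remainder becomes
exactly the CONSTRUCTION-SHAPED classes, which are TYPED (missing-input `Prop`s), NOT attempted.
This is not "finishing BSD". Theorems only; NO named fact is introduced; X9's label (typed) is not
changed; no pair is booked by this file (the lane books, the referee rules).

## The observation (our own work, hence `Summits/`)

Gen 9 (`X9/IwasawaLowerBound.lean`) proved the rank-0 half: Burungale–Castella–Skinner 2025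
Thm. 1.1.2 (a) (`char_Λ X = (g)`, `ι g = p^k · L_p(f, α)`, NO image hypothesis) plus ONE unit
coefficient of `L_p(f, α)` forces `k ≥ 0`, and the rank-0 Euler-characteristic chain then reads
`ord_p #Ш_an = ord_p #Ш − k ≤ ord_p #Ш`.  This file runs the SAME exponent through the rank-ONE chain
of the cell's x1b seat (`Wuthrich2014/RankOneEngineProofs.lean`, Perrin-Riou–Schneider + Perrin-Riou
1987): with `g` a generator of `char_Λ X`, Perrin-Riou–Schneider (Balakrishnan–Müller–Stein Thm. 1.7,
named fact `Schneider1985_order_charGenerator`) gives `g = T · g₁` and, granted the Schneider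
certificate `Reg_p ≠ 0` and `Ш[p^∞]` finite (GZK), the leading term
`[T¹]g · log_p γ · #E(ℚ)_tors² ∼ (1 − α⁻¹)² · #Ш[p^∞] · Reg_p · ∏ c_ℓ`; Perrin-Riou's comparison
(`perrinRiou_rankOne_leadingTerms`: `[T¹]L_p · log_p γ = q (1 − α⁻¹)² Reg_p`, `L'(E,1) = q Ω⁺_f Reg_∞`)
and `[T¹]ι g = p^k [T¹]L_p` turn this into `p^k · #Ш(E)_an = ϖ · u · #Ш[p^∞]` in `ℚ_p` (`u ∈ ℤ_p^×`,
`ϖ Ω_E = Ω⁺_f` a `p`-adic unit by the Greenberg–Vatsal period fact), i.e.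

  **`ord_p #Ш(E)_an + k = ord_p #Ш(E)`** (`padicValRat_shaAn_add_exponent_of_analyticRank_eq_one`).

With the unit coefficient (`k ≥ 0`, gen 9's `exponent_nonneg_of_exists_norm_coeff_eq_one`) this is
the typed LOWER half `Typed.MissingLowerBoundAt W p` in analytic rank 1
(`missingLowerBoundAt_of_unitCoeff_of_analyticRank_eq_one`), hence in rank `≤ 1`
(`…_of_analyticRank_le_one`, the Schneider certificate entering only in rank 1), and on class X9 in
BOTH ranks the typed residue `Typed.X9.MissingInputAt` is EXACTLY the Euler-system half
(`missingInputAt_of_missingUpperBoundAt_of_unitCoeff_of_analyticRank_le_one`,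
`bsdp_iff_missingUpperBoundAt_of_classX9_of_unitCoeff_of_analyticRank_le_one`).  Closures (Cha /
Jetchev–Cha in either rank; the `μ`-typing `BSD(E,p) ⟺ μ = 0` in rank 1) are in the companion
`X9/IwasawaLowerBoundRankOneClosure.lean`.  No `μ`-conjecture, no Kato divisibility (unavailable on
X9: `ρ̄` not surjective), no visibility.

Certificates (per pair, finite `p`-adic computations; Stein–Wuthrich 2013 §§3–4): `hcert` — some
coefficient of `𝓛_MSD(E) = ϖ · L_p(f, α)` is a `p`-adic unit (index `≥ 1` in rank 1); `hSch` —
Schneider's non-degeneracy of THE canonical `p`-adic height (⟺ `[T¹]L_p(f, α) ≠ 0`); when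
`‖[T¹]L_p‖ = 1` one coefficient is both (`…_of_norm_coeff_one_eq_one`).

## References

* [BurungaleCastellaSkinner2025] IMRN 2025 = arXiv:2405.00270v2, Thm. 1.1.2 (a) (p. 2).
* [BalakrishnanMullerStein2015] Math. Comp. 85 (2016), Thm. 1.7 (Perrin-Riou–Schneider).
* [PerrinRiou1987] Invent. Math. 89 (1987), §1.4 Cor. 1.8.
* [SteinWuthrich2013] Math. Comp. 82 (2013), §§3–4, §9; [GreenbergVatsal2000] §3 Rem. (3.4); [Miller2011LMS] Def. 1.1.
-/

set_option autoImplicit false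

noncomputable section

open scoped Classical MatrixGroups ModularForm

open CongruenceSubgroup WeierstrassCurve Literature.NumberTheory.EllipticCurves
  Literature.NumberTheory.EllipticCurves.ModularForms Literature.NumberTheory.EllipticCurves.Rank1Residual

namespace Summit.BirchSwinnertonDyer.Rank1Residual.X9

/-! ### The rank-one valuation chain with an exponent -/

/-- **The rank-one chain with an exponent.**  Let `W` be globally minimal, `p ≥ 5` good ordinary,
`ord_{s=1} L(E,s) = 1`, `(κ, γ)` cyclotomic, `f` a newform of `E`, `ϖ` the rational with
`ϖ·Ω_E = Ω⁺_f` and `ord_p ϖ = 0`, `Dh` THE canonical `p`-adic height with `Reg_p ≠ 0` (`hSch`), `D` a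
dual datum with `X` torsion and `char_Λ X = (g)` where `ι g = p^k · L_p(f, α)` (`k ∈ ℤ`, the shape
of BCS 2025 Thm. 1.1.2 (a)).  Then `#Ш(E)_an = s ∈ ℚ^×` with `ord_p s + k = ord_p #Ш(E)`.  Inputs:
Perrin-Riou–Schneider (`hS`, clauses 1 and 3 for the generator `g`), Perrin-Riou 1987 (`hPR`, via
`Wuthrich2014.exists_rat_leadingTerms_of_analyticRank_eq_one`), Gross–Zagier–Kolyvagin (`hGZK`).
Mechanism: `[T¹]ι g = p^k [T¹]L_p`; `[T¹]g · log_p γ · #tors² = u (1−α⁻¹)² #Ш[p^∞] Reg_p ∏c_ℓ`;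
`[T¹]L_p · log_p γ = q (1−α⁻¹)² Reg_p`; cancel `(1−α⁻¹)² Reg_p ≠ 0`: `p^k q #tors² = u #Ш[p^∞] ∏c_ℓ`,
and `#Ш_an = q ϖ #tors²/∏c_ℓ`.  (For `k = 0` and a non-generator this is the x1b engine
`Wuthrich2014.exists_cofactor_of_mem_charIdeal_of_rank_one`.)
[cite: BalakrishnanMullerStein2015, Thm. 1.7] [cite: PerrinRiou1987, §1.4 Cor. 1.8]
[cite: SteinWuthrich2013, §9] -/
theorem padicValRat_shaAn_add_exponent_of_analyticRank_eq_one
    (hS : Schneider1985_order_charGenerator) (hPR : perrinRiou_rankOne_leadingTerms)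
    (hGZK : rank_eq_analyticRank_of_analyticRank_le_one)
    (W : WeierstrassCurve ℚ) [W.IsElliptic] [W.IsGloballyMinimal] (p : ℕ) [Fact p.Prime]
    (hp : 5 ≤ p) (hgood : W.HasGoodReductionAtPrime p) (hordp : ¬ (p : ℤ) ∣ W.frobeniusTrace p)
    (han : W.analyticRank = 1)
    {κ : ZpExtension ℚ p} {γ : Field.absoluteGaloisGroup ℚ} {N : ℕ} [NeZero N]
    {f : CuspForm (Gamma0 N) 2} (hκ : κ.IsCyclotomic) (hγ : κ.IsTopGenerator γ)
    (hγ' : IsCyclotomicVariable p γ) (hf : IsNewformOf W f) (ϖ : ℚ)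
    (hϖ : (ϖ : ℝ) * W.realPeriodRat = plusPeriod f) (hϖv : padicValRat p ϖ = 0)
    (Dh : PAdicHeightData W p) (hDh : Dh.IsCanonical) (hSch : SchneiderConjecture Dh)
    (D : W.SelmerDualData κ γ) (hX : D.IsTorsion) (g : IwasawaAlgebra p) (k : ℤ)
    (hchar : D.charIdeal = Ideal.span {g})
    (hιg : iwasawaToPowerSeries p g =
      PowerSeries.C ((p : ℚ_[p]) ^ k) * padicLFunction f (unitRoot W p : ℚ_[p])) :
    ∃ s : ℚ, shaAn W = (s : ℂ) ∧ s ≠ 0 ∧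
      padicValRat p s + k = (padicValNat p W.shaOrder : ℤ) := by
  -- adapted from Literature/NumberTheory/EllipticCurves/Wuthrich2014/RankOneEngineProofs.lean
  -- (`exists_cofactor_of_mem_charIdeal_of_rank_one`), with `ϖ` replaced by `p^k` on the Iwasawa side
  have hpP : p.Prime := Fact.out
  have hordin : IsOrdinaryAt W p := ⟨hgood, hordp⟩
  -- Gross–Zagier–Kolyvagin: rank one, `Ш` finite
  obtain ⟨hrk, hfin⟩ := hGZK W han.le
  haveI : Finite W.sha := hfin
  set r := W.mordellWeilRank with hr_def
  have hr1 : r = 1 := hrk.trans han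
  set L := padicLFunction f (unitRoot W p : ℚ_[p]) with hL_def
  -- Perrin-Riou's comparison
  obtain ⟨q, hq0, hlead, hpad⟩ :=
    Wuthrich2014.exists_rat_leadingTerms_of_analyticRank_eq_one hPR hGZK W p hp hordin han Dh hDh f hf
  have hϖ0 : ϖ ≠ 0 := by
    rintro rfl
    have hper : 0 < plusPeriod f := IsNewform0.plusPeriod_pos_holds hf.1 hf.coeffField_eq_bot
    rw [← hϖ, Rat.cast_zero, zero_mul] at hper
    exact lt_irrefl _ hper
  have hϖQ : (ϖ : ℚ_[p]) ≠ 0 := by exact_mod_cast hϖ0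
  have hpk0 : (p : ℚ_[p]) ^ k ≠ 0 := zpow_ne_zero k (Nat.cast_ne_zero.mpr hpP.ne_zero)
  -- the Iwasawa module; Perrin-Riou–Schneider for the generator `g`
  haveI : Module.Finite (IwasawaAlgebra p) D.X := D.module_finite_holds hγ
  obtain ⟨qq, hqq⟩ := Schneider1985_order_charGenerator.X_pow_dvd hS hp hgood hordp hκ hγ hγ' D hX
    hchar hDh
  have hcoeff_g : (PowerSeries.coeff r g : ℤ_[p]) = PowerSeries.constantCoeff qq := by
    rw [hqq, PowerSeries.coeff_X_pow_mul', if_pos le_rfl, Nat.sub_self,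
      PowerSeries.coeff_zero_eq_constantCoeff]
  have hcoeff_ιg : ((PowerSeries.coeff r g : ℤ_[p]) : ℚ_[p]) =
      (p : ℚ_[p]) ^ k * PowerSeries.coeff r L := by
    rw [← Wuthrich2014.coeff_iwasawaToPowerSeries p g r, hιg, PowerSeries.coeff_C_mul]
  have hfinp : Finite (AddCommGroup.primaryComponent W.sha p) := inferInstance
  obtain ⟨u, hu⟩ := Schneider1985_order_charGenerator.leadingCoeff hS hp hgood hordp hκ hγ hγ' D hX
    hchar hDh hSch hfinp
  -- abbreviations in `ℚ_p`
  set pk : ℚ_[p] := (p : ℚ_[p]) ^ k with hpk_def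
  set lg : ℚ_[p] := padicLog p (cyclotomicGenerator p) ^ r with hlg_def
  set T2 : ℚ_[p] := (W.torsionOrder : ℚ_[p]) ^ 2 with hT2_def
  set ε : ℚ_[p] := (1 - (unitRoot W p : ℚ_[p])⁻¹) ^ 2 with hε_def
  set Shp : ℚ_[p] := (Nat.card (AddCommGroup.primaryComponent W.sha p) : ℚ_[p]) with hShp_def
  set Rg : ℚ_[p] := padicRegulator Dh with hRg_def
  set Cc : ℚ_[p] := (W.tamagawaProduct : ℚ_[p]) with hCc_def
  -- Perrin-Riou at index `r`: `[T^r]L · log^r = q · ε · Reg_p`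
  have hpad' : PowerSeries.coeff r L * lg = (q : ℚ_[p]) * ε * Rg := by
    rw [hlg_def, hr1, pow_one]; exact hpad
  -- the identity `pk [T^r]L · lg · T2 = u · ε · Shp · Rg · Cc`
  have key : pk * PowerSeries.coeff r L * lg * T2 =
      ((u : ℤ_[p]) : ℚ_[p]) * (ε * (Shp * (Rg * Cc))) := by
    calc pk * PowerSeries.coeff r L * lg * T2
        = ((PowerSeries.coeff r g : ℤ_[p]) : ℚ_[p]) * lg * T2 := by rw [hcoeff_ιg]
      _ = ((u : ℤ_[p]) : ℚ_[p]) * (ε * (Shp * (Rg * Cc))) := by rw [hu]; ring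
  -- hence `pk q T2 = u · Shp · Cc` (cancel `ε · Rg ≠ 0`)
  obtain ⟨u₂, hu₂⟩ := exists_unit_one_sub_unitRoot_inv p W hordin
  have hε0 : ε ≠ 0 := by
    rw [hε_def, hu₂]
    refine pow_ne_zero 2 (mul_ne_zero (coe_units_ne_zero p u₂) ?_)
    exact_mod_cast (W.reductionPointCount_pos p).ne'
  have hRg0 : Rg ≠ 0 := hSch
  have hShp0 : Shp ≠ 0 := by rw [hShp_def]; exact_mod_cast Nat.card_pos.ne'
  have hCc0 : Cc ≠ 0 := by
    rw [hCc_def]; exact_mod_cast (W.tamagawaProduct_pos_holds : 0 < W.tamagawaProduct).ne'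
  have key2 : pk * (q : ℚ_[p]) * T2 = ((u : ℤ_[p]) : ℚ_[p]) * Shp * Cc := by
    apply mul_right_cancel₀ (mul_ne_zero hε0 hRg0)
    calc pk * (q : ℚ_[p]) * T2 * (ε * Rg)
        = pk * (PowerSeries.coeff r L * lg) * T2 := by rw [hpad']; ring
      _ = pk * PowerSeries.coeff r L * lg * T2 := by ring
      _ = ((u : ℤ_[p]) : ℚ_[p]) * (ε * (Shp * (Rg * Cc))) := key
      _ = ((u : ℤ_[p]) : ℚ_[p]) * Shp * Cc * (ε * Rg) := by ring
  -- the analytic order of `Ш`: `#Ш_an = q ϖ #E(ℚ)_tors² / ∏ c_ℓ`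
  set s : ℚ := q * ϖ * (W.torsionOrder : ℚ) ^ 2 / (W.tamagawaProduct : ℚ) with hs_def
  have hΩpos : 0 < W.realPeriodRat := W.realPeriodRat_pos_holds
  have hRegpos : 0 < W.regulator := regulator_pos_holds W
  have htamQ : (W.tamagawaProduct : ℚ) ≠ 0 := by
    exact_mod_cast (W.tamagawaProduct_pos_holds : 0 < W.tamagawaProduct).ne'
  have hTQ : (W.torsionOrder : ℚ) ≠ 0 := by exact_mod_cast (W.torsionOrder_pos_holds).ne'
  have hsha : shaAn W = (s : ℂ) := by
    have hΩC : (W.realPeriodRat : ℂ) ≠ 0 := by exact_mod_cast hΩpos.ne'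
    have hRegC : (W.regulator : ℂ) ≠ 0 := by exact_mod_cast hRegpos.ne'
    have htamC : (W.tamagawaProduct : ℂ) ≠ 0 := by exact_mod_cast htamQ
    have hper : (plusPeriod f : ℂ) = (ϖ : ℂ) * (W.realPeriodRat : ℂ) := by
      rw [← hϖ]; push_cast; ring
    rw [shaAn_def, hlead, hs_def]
    push_cast
    rw [hper]
    field_simp
  have hs0 : s ≠ 0 := by
    rw [hs_def]
    exact div_ne_zero (mul_ne_zero (mul_ne_zero hq0 hϖ0) (pow_ne_zero 2 hTQ)) htamQ
  -- `s · pk = ϖ · u · Shp` in `ℚ_p`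
  have hsQ : ((s : ℚ) : ℚ_[p]) * pk = (ϖ : ℚ_[p]) * ((u : ℤ_[p]) : ℚ_[p]) * Shp := by
    have hCcN : (W.tamagawaProduct : ℚ_[p]) ≠ 0 := by
      exact_mod_cast (W.tamagawaProduct_pos_holds : 0 < W.tamagawaProduct).ne'
    have key3 : pk * (q : ℚ_[p]) * (W.torsionOrder : ℚ_[p]) ^ 2 =
        ((u : ℤ_[p]) : ℚ_[p]) * Shp * (W.tamagawaProduct : ℚ_[p]) := key2
    rw [hs_def]
    push_cast
    rw [div_mul_eq_mul_div, div_eq_iff hCcN]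
    linear_combination (ϖ : ℚ_[p]) * key3
  -- valuations
  have hsQ0 : ((s : ℚ) : ℚ_[p]) ≠ 0 := by exact_mod_cast hs0
  have hvS : Shp.valuation = (padicValNat p W.shaOrder : ℤ) := by
    rw [hShp_def, Padic.valuation_natCast, padicValNat_card_addPrimaryComponent,
      WeierstrassCurve.shaOrder]
  have hvpk : pk.valuation = k := by
    rw [hpk_def, Padic.valuation_zpow, Padic.valuation_p, mul_one]
  have hvϖ : ((ϖ : ℚ) : ℚ_[p]).valuation = 0 := by rw [Padic.valuation_ratCast, hϖv]
  have hval := congrArg Padic.valuation hsQ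
  rw [Padic.valuation_mul hsQ0 hpk0, Padic.valuation_ratCast, hvpk,
    Padic.valuation_mul (mul_ne_zero hϖQ (coe_units_ne_zero p u)) hShp0,
    Padic.valuation_mul hϖQ (coe_units_ne_zero p u), valuation_coe_units_eq_zero, add_zero,
    hvS] at hval
  refine ⟨s, hsha, hs0, ?_⟩
  have hvϖ' : (ϖ : ℚ_[p]).valuation = 0 := hvϖ
  rw [hvϖ', zero_add] at hval
  exact hval


/-! ### The lower bound in analytic rank one, and in rank `≤ 1` -/

variable (W : WeierstrassCurve ℚ) [W.IsElliptic] [W.IsGloballyMinimal] (p : ℕ) [Fact p.Prime]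

/-- The period ratio `ϖ` (`ϖ·Ω_E = Ω⁺_f`) has `ord_p ϖ = 0` at a good `p ≥ 5` with `E[p]`
irreducible (Greenberg–Vatsal's period unit, `norm_periodRatio_eq_one`, restated as a valuation).
Bookkeeping. [cite: GreenbergVatsal2000, §3 Remark (3.4)] -/
theorem padicValRat_periodRatio_eq_zero (h5 : realPeriodRat_eq_unit_mul_plusPeriod)
    (hp : 5 ≤ p) (hgood : W.HasGoodReductionAtPrime p) (hirr : W.HasIrreducibleModPGaloisRep p)
    {N : ℕ} [NeZero N] (f : CuspForm (Gamma0 N) 2) (hf : IsNewformOf W f) (ϖ : ℚ)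
    (hϖeq : (ϖ : ℝ) * W.realPeriodRat = plusPeriod f) : padicValRat p ϖ = 0 := by
  have hpP : p.Prime := Fact.out
  have hϖnorm : ‖(ϖ : ℚ_[p])‖ = 1 := norm_periodRatio_eq_one h5 W p hp hgood hirr f hf ϖ hϖeq
  have hϖ0 : ϖ ≠ 0 := by
    rintro rfl
    simp at hϖnorm
  have h := Padic.norm_eq_zpow_neg_valuation (show ((ϖ : ℚ) : ℚ_[p]) ≠ 0 by exact_mod_cast hϖ0)
  rw [hϖnorm, Padic.valuation_ratCast] at h
  have hp1 : (1 : ℝ) < p := by exact_mod_cast hpP.one_lt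
  have h0 : (p : ℝ) ^ (0 : ℤ) = (p : ℝ) ^ (-padicValRat p ϖ) := by rw [zpow_zero]; exact h
  have := zpow_right_injective₀ (zero_lt_one.trans hp1) hp1.ne' h0
  omega

/-- **Analytic rank 1, `p ≥ 5` good ordinary, `E[p]` irreducible: `ord_p #Ш(E)_an ≤ ord_p #Ш(E)`
from PUBLISHED theorems plus two finite certificates.**  Binders: BCS 2025 Thm. 1.1.2 (a) (`hBCS`:
`char X = (g)`, `ι g = p^k L_p(f,α)`, NO image hypothesis), Perrin-Riou–Schneider (`hS`), Perrin-Riou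
1987 (`hPR`), the period unit (`h5`), modularity (`hmodP`), Gross–Zagier–Kolyvagin (`hGZK`); the
certificates: `hSch` — Schneider's non-degeneracy of THE canonical `p`-adic height (⟺ `[T¹]L_p ≠ 0`),
`hcert` — SOME coefficient of `𝓛_MSD(E) = ϖ·L_p(f, α)` is a `p`-adic unit.  Proof: `k ≥ 0`
(gen 9's `exponent_nonneg_of_exists_norm_coeff_eq_one`) and the rank-one chain
`padicValRat_shaAn_add_exponent_of_analyticRank_eq_one` (`ord_p #Ш_an + k = ord_p #Ш`).  No
`μ`-conjecture, no Kato divisibility, any image of `ρ̄_{E,p}`.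
[cite: BurungaleCastellaSkinner2025, Thm. 1.1.2 (a) (p. 2 of arXiv:2405.00270v2)]
[cite: BalakrishnanMullerStein2015, Thm. 1.7] [cite: PerrinRiou1987, §1.4 Cor. 1.8] -/
theorem missingLowerBoundAt_of_unitCoeff_of_analyticRank_eq_one
    (hBCS : burungale_castella_skinner_charIdeal_eq_padicLFunction)
    (hS : Schneider1985_order_charGenerator) (hPR : perrinRiou_rankOne_leadingTerms)
    (h5 : realPeriodRat_eq_unit_mul_plusPeriod) (hmodP : nonempty_modularParametrizationData)
    (hGZK : rank_eq_analyticRank_of_analyticRank_le_one)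
    (hp : 5 ≤ p) (hord : GoodOrd W p) (hirr : Irr W p) (hr : W.analyticRank = 1)
    (hSch : ∀ Dh : PAdicHeightData W p, Dh.IsCanonical → SchneiderConjecture Dh)
    (hcert : ∀ [NeZero (W.conductorNorm ℤ)] (f : CuspForm (Gamma0 (W.conductorNorm ℤ)) 2),
        IsNewformOf W f → ∀ (ϖ : ℚ), (ϖ : ℝ) * W.realPeriodRat = plusPeriod f →
      ∃ n : ℕ, ‖PowerSeries.coeff n
        (PowerSeries.C (ϖ : ℚ_[p]) * padicLFunction f (unitRoot W p : ℚ_[p]))‖ = 1) :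
    Typed.MissingLowerBoundAt W p := by
  obtain ⟨hgood, hordp⟩ := hord
  -- the newform and the period ratio
  haveI : NeZero (W.conductorNorm ℤ) := ⟨(W.conductorNorm_pos_holds).ne'⟩
  obtain ⟨Dm⟩ := hmodP W
  have hf : IsNewformOf W Dm.f := Dm.isNewformOf
  obtain ⟨ϖ, -, hϖeq, -⟩ := Dm.exists_rat_mul_realPeriodRat_eq_plusPeriod
  have hϖnorm : ‖(ϖ : ℚ_[p])‖ = 1 := norm_periodRatio_eq_one h5 W p hp hgood hirr Dm.f hf ϖ hϖeq
  have hϖv : padicValRat p ϖ = 0 := padicValRat_periodRatio_eq_zero W p h5 hp hgood hirr Dm.f hf ϖ hϖeq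
  -- the cyclotomic setting, a dual datum, the canonical height
  obtain ⟨κ, hκ, γ, hγ, hγ'⟩ := exists_isCyclotomic_isTopGenerator_isCyclotomicVariable_holds p
  obtain ⟨D⟩ := W.nonempty_selmerDualData_holds κ γ hγ
  obtain ⟨Dh, hDh, -⟩ := existsUnique_isCanonical_holds W p hp hgood hordp
  -- BCS (a): `char X = (g)`, `ι g = p^k · L_p(f, α)`
  obtain ⟨hX, g, k, hchar, hιg⟩ := hBCS W p κ γ Dm.f hp hgood hordp hirr hκ hγ hγ' hf D
  -- `k ≥ 0` from the certificate
  have hcert' : ∃ n : ℕ, ‖PowerSeries.coeff n (padicLFunction Dm.f (unitRoot W p : ℚ_[p]))‖ = 1 := by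
    obtain ⟨n, hn⟩ := hcert Dm.f hf ϖ hϖeq
    refine ⟨n, ?_⟩
    rwa [PowerSeries.coeff_C_mul, norm_mul, hϖnorm, one_mul] at hn
  have hk : 0 ≤ k := exponent_nonneg_of_exists_norm_coeff_eq_one g _ k hιg hcert'
  -- the rank-one chain with exponent `k`
  obtain ⟨s, hsha, -, hval⟩ := padicValRat_shaAn_add_exponent_of_analyticRank_eq_one hS hPR hGZK W p
    hp hgood hordp hr hκ hγ hγ' hf ϖ hϖeq hϖv Dh hDh (hSch Dh hDh) D hX g k hchar hιg
  exact ⟨s, hsha, by linarith⟩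

/-- **Analytic rank `≤ 1`: the LOWER half `ord_p #Ш_an ≤ ord_p #Ш`** — gen 9's rank-0 theorem
(`missingLowerBoundAt_of_unitCoeff_of_analyticRank_eq_zero`, Greenberg Thm. 4.1 `hGr`, modularity
`hmodL`) and the rank-1 theorem above, the Schneider certificate being asked only in rank 1
(`hSch : W.analyticRank = 1 → …`). [cite: BurungaleCastellaSkinner2025, Thm. 1.1.2 (a) (p. 2 of arXiv:2405.00270v2)]
[cite: GreenbergLNM1716, Thm. 4.1 (p. 102)] [cite: BalakrishnanMullerStein2015, Thm. 1.7] -/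
theorem missingLowerBoundAt_of_unitCoeff_of_analyticRank_le_one
    (hBCS : burungale_castella_skinner_charIdeal_eq_padicLFunction)
    (hGr : greenberg_charValue_rankZero) (h5 : realPeriodRat_eq_unit_mul_plusPeriod)
    (hS : Schneider1985_order_charGenerator) (hPR : perrinRiou_rankOne_leadingTerms)
    (hmodP : nonempty_modularParametrizationData) (hmodL : hasEntireLFunction_rat)
    (hGZK : rank_eq_analyticRank_of_analyticRank_le_one)
    (hp : 5 ≤ p) (hord : GoodOrd W p) (hirr : Irr W p) (hr : W.analyticRank ≤ 1)
    (hSch : W.analyticRank = 1 → ∀ Dh : PAdicHeightData W p, Dh.IsCanonical → SchneiderConjecture Dh)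
    (hcert : ∀ [NeZero (W.conductorNorm ℤ)] (f : CuspForm (Gamma0 (W.conductorNorm ℤ)) 2),
        IsNewformOf W f → ∀ (ϖ : ℚ), (ϖ : ℝ) * W.realPeriodRat = plusPeriod f →
      ∃ n : ℕ, ‖PowerSeries.coeff n
        (PowerSeries.C (ϖ : ℚ_[p]) * padicLFunction f (unitRoot W p : ℚ_[p]))‖ = 1) :
    Typed.MissingLowerBoundAt W p := by
  rcases Nat.le_one_iff_eq_zero_or_eq_one.mp hr with hr0 | hr1
  · exact missingLowerBoundAt_of_unitCoeff_of_analyticRank_eq_zero W p hBCS hGr h5 hmodP hmodL hGZK hp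
      hord hirr hr0 hcert
  · exact missingLowerBoundAt_of_unitCoeff_of_analyticRank_eq_one W p hBCS hS hPR h5 hmodP hGZK hp
      hord hirr hr1 (hSch hr1) hcert

/-- **Rank 1 with both certificates read off ONE coefficient**: if `[T¹]L_p(f, α)` is a `p`-adic UNIT
for the newform `f` of `E` at level `N_E`, it is at once the analytic certificate (a unit coefficient
of `𝓛_MSD(E)`, as `‖ϖ‖_p = 1`) and — via `Wuthrich2014.coeff_one_padicLFunction_ne_zero_iff_schneider`
— the Schneider certificate; so `ord_p #Ш_an ≤ ord_p #Ш` follows from the published binders alone.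
(Census reading: `λ(𝓛_p(E)) = 1`.) [cite: PerrinRiou1987, §1.4 Cor. 1.8]
[cite: SteinWuthrich2013, §§3–4 and §9] [cite: BalakrishnanMullerStein2015, Thm. 1.7] -/
theorem missingLowerBoundAt_of_norm_coeff_one_eq_one_of_analyticRank_eq_one
    (hBCS : burungale_castella_skinner_charIdeal_eq_padicLFunction)
    (hS : Schneider1985_order_charGenerator) (hPR : perrinRiou_rankOne_leadingTerms)
    (h5 : realPeriodRat_eq_unit_mul_plusPeriod) (hmodP : nonempty_modularParametrizationData)
    (hGZK : rank_eq_analyticRank_of_analyticRank_le_one)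
    (hp : 5 ≤ p) (hord : GoodOrd W p) (hirr : Irr W p) (hr : W.analyticRank = 1)
    (hone : ∀ [NeZero (W.conductorNorm ℤ)] (f : CuspForm (Gamma0 (W.conductorNorm ℤ)) 2),
        IsNewformOf W f → ‖PowerSeries.coeff 1 (padicLFunction f (unitRoot W p : ℚ_[p]))‖ = 1) :
    Typed.MissingLowerBoundAt W p := by
  obtain ⟨hgood, hordp⟩ := id hord
  haveI : NeZero (W.conductorNorm ℤ) := ⟨(W.conductorNorm_pos_holds).ne'⟩
  obtain ⟨Dm⟩ := hmodP W
  have hf : IsNewformOf W Dm.f := Dm.isNewformOf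
  have h1 := hone Dm.f hf
  have hne : PowerSeries.coeff 1 (padicLFunction Dm.f (unitRoot W p : ℚ_[p])) ≠ 0 :=
    norm_pos_iff.mp (by rw [h1]; exact one_pos)
  refine missingLowerBoundAt_of_unitCoeff_of_analyticRank_eq_one W p hBCS hS hPR h5 hmodP hGZK hp hord
    hirr hr (fun Dh hDh => ?_) ?_
  · exact (Wuthrich2014.coeff_one_padicLFunction_ne_zero_iff_schneider hPR hGZK W p hp
      ⟨hgood, hordp⟩ hr Dh hDh Dm.f hf).mp hne
  · intro _ f hf' ϖ hϖeq
    refine ⟨1, ?_⟩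
    rw [PowerSeries.coeff_C_mul, norm_mul, norm_periodRatio_eq_one h5 W p hp hgood hirr f hf' ϖ hϖeq,
      one_mul]
    exact hone f hf'

/-! ### Class X9, both ranks: the typed residue is the Euler-system half -/

/-- **On X9 in analytic rank `≤ 1` the typed residue is the UPPER half only.**  Granted the published
binders and the certificates (`μ(𝓛_p(E)) = 0`; Schneider in rank 1), any upper bound
`ord_p #Ш ≤ ord_p #Ш_an` (`Typed.MissingUpperBoundAt W p` — Cha / Jetchev–Cha index certificates,
descents, an Euler-system bound without big image) completes the typed input
`Typed.X9.MissingInputAt W p`.  Rank-`≤ 1` form of gen 9's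
`missingInputAt_of_missingUpperBoundAt_of_unitCoeff`. [cite: Miller2011LMS, Def. 1.1]
[cite: BurungaleCastellaSkinner2025, Thm. 1.1.2 (a) (p. 2 of arXiv:2405.00270v2)] -/
theorem missingInputAt_of_missingUpperBoundAt_of_unitCoeff_of_analyticRank_le_one
    (hBCS : burungale_castella_skinner_charIdeal_eq_padicLFunction)
    (hGr : greenberg_charValue_rankZero) (h5 : realPeriodRat_eq_unit_mul_plusPeriod)
    (hS : Schneider1985_order_charGenerator) (hPR : perrinRiou_rankOne_leadingTerms)
    (hmodP : nonempty_modularParametrizationData) (hmodL : hasEntireLFunction_rat)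
    (hGZK : rank_eq_analyticRank_of_analyticRank_le_one)
    (hX9 : ClassX9 W p) (hr : W.analyticRank ≤ 1) (hup : Typed.MissingUpperBoundAt W p)
    (hSch : W.analyticRank = 1 → ∀ Dh : PAdicHeightData W p, Dh.IsCanonical → SchneiderConjecture Dh)
    (hcert : ∀ [NeZero (W.conductorNorm ℤ)] (f : CuspForm (Gamma0 (W.conductorNorm ℤ)) 2),
        IsNewformOf W f → ∀ (ϖ : ℚ), (ϖ : ℝ) * W.realPeriodRat = plusPeriod f →
      ∃ n : ℕ, ‖PowerSeries.coeff n
        (PowerSeries.C (ϖ : ℚ_[p]) * padicLFunction f (unitRoot W p : ℚ_[p]))‖ = 1) :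
    Typed.X9.MissingInputAt W p :=
  Typed.missingPPartAt_of_lower_of_upper W p
    (missingLowerBoundAt_of_unitCoeff_of_analyticRank_le_one W p hBCS hGr h5 hS hPR hmodP hmodL hGZK
      hX9.2.2.1 hX9.2.1 hX9.2.2.2.1 hr hSch hcert) hup

/-- **The X9 residue is EXACTLY the Euler-system half, in BOTH ranks.**  On class X9 with
`r_an ≤ 1`, granted the published binders and the certificates:
`BSDp W p ↔ Typed.MissingUpperBoundAt W p`.  Rank-`≤ 1` form of gen 9's
`bsdp_iff_missingUpperBoundAt_of_classX9_of_unitCoeff`. [cite: Miller2011LMS, Def. 1.1] -/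
theorem bsdp_iff_missingUpperBoundAt_of_classX9_of_unitCoeff_of_analyticRank_le_one
    (hBCS : burungale_castella_skinner_charIdeal_eq_padicLFunction)
    (hGr : greenberg_charValue_rankZero) (h5 : realPeriodRat_eq_unit_mul_plusPeriod)
    (hS : Schneider1985_order_charGenerator) (hPR : perrinRiou_rankOne_leadingTerms)
    (hmodP : nonempty_modularParametrizationData) (hmodL : hasEntireLFunction_rat)
    (hGZK : rank_eq_analyticRank_of_analyticRank_le_one)
    (hX9 : ClassX9 W p) (hr : W.analyticRank ≤ 1)
    (hSch : W.analyticRank = 1 → ∀ Dh : PAdicHeightData W p, Dh.IsCanonical → SchneiderConjecture Dh)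
    (hcert : ∀ [NeZero (W.conductorNorm ℤ)] (f : CuspForm (Gamma0 (W.conductorNorm ℤ)) 2),
        IsNewformOf W f → ∀ (ϖ : ℚ), (ϖ : ℝ) * W.realPeriodRat = plusPeriod f →
      ∃ n : ℕ, ‖PowerSeries.coeff n
        (PowerSeries.C (ϖ : ℚ_[p]) * padicLFunction f (unitRoot W p : ℚ_[p]))‖ = 1) :
    BSDp W p ↔ Typed.MissingUpperBoundAt W p := by
  haveI : Finite W.sha := (hGZK W hr).2
  constructor
  · intro h
    exact (Typed.lower_and_upper_of_missingPPartAt W p (Typed.missingPPartAt_of_bsdp W p h)).2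
  · intro hup
    exact Typed.bsdp_of_missingPPartAt W p hGZK hr
      (missingInputAt_of_missingUpperBoundAt_of_unitCoeff_of_analyticRank_le_one W p hBCS hGr h5 hS
        hPR hmodP hmodL hGZK hX9 hr hup hSch hcert)

end Summit.BirchSwinnertonDyer.Rank1Residual.X9

end
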